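import Literature.AlgebraicGeometry.Deformation.SmallExtensionFactorization
import HarnessLib

/-!
# [Schlessinger1968, §1]: essential surjections in `Art_k` (Def. 1.3), Lemma 1.4 (ii) — a small extension is
not essential iff it has a section — and base change of small extensions along cartesian squares

Family `hodge` (computation cell `pub-hsemireg`, LIT-W seat «Pridham / derived deformation theory as printed»), layer
`Literature/AlgebraicGeometry/Deformation`. Vocabulary of `T1Lifting.lean` / `SmallExtensionFactorization.lean`:
`ArtAlg` (= Schlessinger's category `C` of Artinian local `k`-algebras with residue field `k`, `Λ = k`),
`IsSmallExtension` (= [Schlessinger1968, Def. 1.2]: `p` onto, `ker p = (t) ≠ 0` principal, `𝔪 · t = 0`).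

[Schlessinger1968, §1, p. 209]: «Let `p : B → A` be a surjection in `C`. […] DEFINITION 1.3. `p` is essential if
for any morphism `q : C → B` in `C` such that `pq` is surjective, it follows that `q` is surjective.» —
`ArtAlg.IsEssential` (definition with body; the test objects `C` range over `Art_k` in the ambient universe).

[Schlessinger1968, Lemma 1.4 (ii), pp. 209–210]: «If `p` is a small extension, then `p` is not essential if and
only if `p` has a section `s : A → B`, with `ps = 1_A`.» — `IsSmallExtension.not_isEssential_iff_exists_section`,
from the two directions `IsSmallExtension.not_isEssential_of_section` («If `p` has a section `s`, then `s` is not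
surjective, so `p` is not essential») and `IsSmallExtension.exists_section_of_not_isEssential` («If `p` is not
essential, then the subring `C` […] is a proper subring of `B`, and hence is isomorphic to `A` […]. The
isomorphism `C ≅ A` yields the section.»). The printed proof measures `C` by LENGTH (`length B = length A + 1`);
here the same conclusion is reached without lengths: the kernel `(t)` of a small extension is the `k`-LINE `k · t`
(`IsSmallExtension.exists_smul_eq_of_mem_ker`: `𝔪 · t = 0` and `B = k ⊕ 𝔪`), so a `k`-subalgebra `C ⊆ B` mapping
onto `A` either meets `(t)` only in `0` — then `p|_C : C → A` is an isomorphism and `C ↪ B` composed with its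
inverse is the section — or contains `t`, hence all of `ker p`, hence equals `B` (`C + ker p = B` because `p|_C`
is onto), contradicting properness. A second section records what the printed hull construction
([Schlessinger1968, proof of Thm. 2.11 (1), p. 214]: «If the small extension `pr₁` has a section, then `v`
obviously exists. Otherwise, by 1.4 (ii), `pr₁` is essential …», `pr₁ : R_q ×_A A′ → R_q` the base change of the
small extension `A′ → A`) uses next to 1.4 (ii): in a CARTESIAN square of `Art_k` (`T1Lifting.lean`'s
`IsCartesian`, any model of the fibre product) over a small extension `p`, the parallel side `p′` is a small
extension (`IsCartesian.isSmallExtension_side`; pieces `surjective_side`, `ker_mul_maximalIdeal_side`, the kernel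
correspondence `eq_of_mem_ker_of_map_eq` / `exists_mem_ker_map_eq` under `q′`, and locality of morphisms
`ArtAlg.map_mem_maximalIdeal`). THEOREMS and one definition with body; no named fact, no `sorry`.
Not here: Lemma 1.4 (i) («`p` is essential iff `p* : t*_B → t*_A` is an isomorphism», which goes through Lemma 1.1's
cotangent-space criterion for surjectivity) and Def. 1.2 itself (it is `IsSmallExtension`).

## References

* [Schlessinger1968] M. Schlessinger, Functors of Artin rings, Trans. Amer. Math. Soc. 130 (1968) 208–222:
  Def. 1.2, Def. 1.3, Lemma 1.4 (pp. 209–210).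
* [StacksProject] The Stacks Project, Tag 06GD (small extensions in `𝒞_Λ`), Tag 06GH (fibre products in `𝒞_Λ`).
-/

namespace Literature.AlgebraicGeometry.Deformation

universe u

open IsLocalRing

section Essential

variable {k : Type u} [Field k] {R₀ R₁ : ArtAlg.{u} k}

/-- **[Schlessinger1968, Def. 1.3] essential surjections.** «`p` is essential if for any morphism `q : C → B` in
`C` such that `pq` is surjective, it follows that `q` is surjective.» (The test objects `C` are the objects of
`Art_k`.) Definition with body. [cite: Schlessinger1968, Def. 1.3, p. 209] -/
def ArtAlg.IsEssential (p : ↥R₁ →ₐ[k] ↥R₀) : Prop :=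
  ∀ ⦃R₂ : ArtAlg.{u} k⦄ (q : ↥R₂ →ₐ[k] ↥R₁), Function.Surjective (p.comp q) → Function.Surjective q

/-- Unfolding lemma for `ArtAlg.IsEssential`. [cite: Schlessinger1968, Def. 1.3, p. 209] -/
theorem ArtAlg.isEssential_iff (p : ↥R₁ →ₐ[k] ↥R₀) :
    ArtAlg.IsEssential p ↔
      ∀ ⦃R₂ : ArtAlg.{u} k⦄ (q : ↥R₂ →ₐ[k] ↥R₁), Function.Surjective (p.comp q) → Function.Surjective q :=
  Iff.rfl

/-- In an object `B` of `Art_k`, an element `t` with `𝔪_B · t = 0` satisfies `b · t = b₀ · t` for every `b`, `b₀ ∈ k`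
the residue of `b` (`B = k · 1 ⊕ 𝔪_B`). [cite: Schlessinger1968, Def. 1.2, p. 209] -/
theorem ArtAlg.mul_eq_residue_smul (aug : ↥R₁ →ₐ[k] k) {t : ↥R₁} (ht : ∀ m ∈ maximalIdeal ↥R₁, m * t = 0)
    (b : ↥R₁) : b * t = aug b • t := by
  have hm : b - algebraMap k ↥R₁ (aug b) ∈ maximalIdeal ↥R₁ := by
    rw [← ArtAlg.ker_augmentation_eq_maximalIdeal R₁ aug, RingHom.mem_ker]
    simp
  have h := ht _ hm
  rw [sub_mul, sub_eq_zero] at h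
  rw [h, Algebra.smul_def]

/-- **The kernel of a small extension is the `k`-line `k · t`:** every element of `ker p = (t)` is `c · t` for a
(unique) scalar `c ∈ k`. [cite: Schlessinger1968, Def. 1.2, p. 209] -/
theorem IsSmallExtension.exists_smul_eq_of_mem_ker {p : ↥R₁ →ₐ[k] ↥R₀} (hp : IsSmallExtension k p) {t : ↥R₁}
    (hker : RingHom.ker p = Ideal.span {t}) {y : ↥R₁} (hy : y ∈ RingHom.ker p) : ∃ c : k, y = c • t := by
  obtain ⟨aug⟩ := R₁.exists_augmentation
  rw [hker] at hy
  obtain ⟨b, rfl⟩ := Ideal.mem_span_singleton'.mp hy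
  refine ⟨aug b, ArtAlg.mul_eq_residue_smul aug (fun m hm => ?_) b⟩
  have h0 : t * m ∈ RingHom.ker p * maximalIdeal ↥R₁ :=
    Ideal.mul_mem_mul (by rw [hker]; exact Ideal.mem_span_singleton_self t) hm
  rw [hp.ker_mul_maximalIdeal, Ideal.mem_bot] at h0
  rwa [mul_comm] at h0

/-- **[Schlessinger1968, Lemma 1.4 (ii)], «if» direction: a small extension with a section is not essential** —
«If `p` has a section `s`, then `s` is not surjective, so `p` is not essential.» (`s` surjective would force
`ker p = 0`.) [cite: Schlessinger1968, Lemma 1.4 (ii), pp. 209–210] -/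
theorem IsSmallExtension.not_isEssential_of_section {p : ↥R₁ →ₐ[k] ↥R₀} (hp : IsSmallExtension k p)
    (s : ↥R₀ →ₐ[k] ↥R₁) (hs : p.comp s = AlgHom.id k ↥R₀) : ¬ ArtAlg.IsEssential p := by
  intro h
  have hsurj : Function.Surjective s := h s (by rw [hs]; exact Function.surjective_id)
  obtain ⟨t, ht0, hker⟩ := hp.exists_ker_eq_span
  have ht : t ∈ RingHom.ker p := by rw [hker]; exact Ideal.mem_span_singleton_self t
  obtain ⟨a, rfl⟩ := hsurj t
  have hpa : p (s a) = a := AlgHom.congr_fun hs a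
  rw [RingHom.mem_ker] at ht
  have ha : a = 0 := by rw [← hpa]; exact ht
  exact ht0 (by rw [ha, map_zero])

/-- A `k`-subalgebra `C ⊆ B` mapping ONTO `A` under the small extension `p : B → A` and missing `B` meets `ker p`
only in `0` (otherwise it contains the line `ker p = k · t`, and `C + ker p = B`). [cite: Schlessinger1968,
Lemma 1.4 (ii) (proof), p. 210] -/
theorem IsSmallExtension.eq_zero_of_mem_ker_of_mem {p : ↥R₁ →ₐ[k] ↥R₀} (hp : IsSmallExtension k p)
    (C : Subalgebra k ↥R₁) (hC : Function.Surjective (p.comp C.val)) (hCtop : C ≠ ⊤) {y : ↥R₁}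
    (hy : y ∈ RingHom.ker p) (hyC : y ∈ C) : y = 0 := by
  by_contra hy0
  obtain ⟨t, -, hker⟩ := hp.exists_ker_eq_span
  obtain ⟨c, rfl⟩ := hp.exists_smul_eq_of_mem_ker hker hy
  have hc : c ≠ 0 := by rintro rfl; exact hy0 (zero_smul k t)
  have htC : t ∈ C := by
    have := C.smul_mem hyC c⁻¹
    rwa [smul_smul, inv_mul_cancel₀ hc, one_smul] at this
  have hkerC : ∀ z ∈ RingHom.ker p, z ∈ C := fun z hz => by
    obtain ⟨d, rfl⟩ := hp.exists_smul_eq_of_mem_ker hker hz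
    exact C.smul_mem htC d
  apply hCtop
  rw [eq_top_iff]
  intro b _
  obtain ⟨x, hx⟩ := hC (p b)
  have hbx : b - (x : ↥R₁) ∈ RingHom.ker p := by
    rw [RingHom.mem_ker, map_sub, sub_eq_zero]
    exact hx.symm
  have := C.add_mem (hkerC _ hbx) x.2
  rwa [sub_add_cancel] at this

/-- **[Schlessinger1968, Lemma 1.4 (ii)], «only if» direction: a small extension that is not essential has a
section** — «If `p` is not essential, then the subring `C` constructed above is a proper subring of `B`, and hence
is isomorphic to `A` […]. The isomorphism `C ≅ A` yields the section.» Here `C` = the image of a non-surjective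
`q : R₂ → B` with `pq` surjective; `p|_C` is injective by `eq_zero_of_mem_ker_of_mem` and onto, and the section is
`C ↪ B` after `(p|_C)⁻¹`. [cite: Schlessinger1968, Lemma 1.4 (ii), pp. 209–210] -/
theorem IsSmallExtension.exists_section_of_not_isEssential {p : ↥R₁ →ₐ[k] ↥R₀} (hp : IsSmallExtension k p)
    (h : ¬ ArtAlg.IsEssential p) : ∃ s : ↥R₀ →ₐ[k] ↥R₁, p.comp s = AlgHom.id k ↥R₀ := by
  simp only [ArtAlg.isEssential_iff, not_forall, exists_prop] at h
  obtain ⟨R₂, q, hpq, hq⟩ := h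
  set C : Subalgebra k ↥R₁ := q.range with hCdef
  have hCval : Function.Surjective (p.comp C.val) := fun a => by
    obtain ⟨r, hr⟩ := hpq a
    exact ⟨⟨q r, q.mem_range_self r⟩, hr⟩
  have hCtop : C ≠ ⊤ := by
    intro hC
    apply hq
    intro b
    have hb : b ∈ C := by rw [hC]; exact Algebra.mem_top
    exact (AlgHom.mem_range q).mp hb
  have hinj : Function.Injective (p.comp C.val) := by
    intro x y hxy
    have hk : (x : ↥R₁) - y ∈ RingHom.ker p := by
      rw [RingHom.mem_ker, map_sub, sub_eq_zero]
      exact hxy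
    have h0 := hp.eq_zero_of_mem_ker_of_mem C hCval hCtop hk (C.sub_mem x.2 y.2)
    exact Subtype.ext (sub_eq_zero.mp h0)
  let e : ↥C ≃ₐ[k] ↥R₀ := AlgEquiv.ofBijective (p.comp C.val) ⟨hinj, hCval⟩
  refine ⟨C.val.comp (e.symm : ↥R₀ →ₐ[k] ↥C), ?_⟩
  rw [← AlgHom.comp_assoc]
  exact AlgEquiv.comp_symm e

/-- **[Schlessinger1968, Lemma 1.4 (ii)] as printed:** «If `p` is a small extension, then `p` is not essential if
and only if `p` has a section `s : A → B`, with `ps = 1_A`.» [cite: Schlessinger1968, Lemma 1.4 (ii), pp. 209–210] -/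
theorem IsSmallExtension.not_isEssential_iff_exists_section {p : ↥R₁ →ₐ[k] ↥R₀} (hp : IsSmallExtension k p) :
    ¬ ArtAlg.IsEssential p ↔ ∃ s : ↥R₀ →ₐ[k] ↥R₁, p.comp s = AlgHom.id k ↥R₀ :=
  ⟨hp.exists_section_of_not_isEssential, fun ⟨s, hs⟩ => hp.not_isEssential_of_section s hs⟩

/-- Equivalently: a small extension is essential iff it has NO section. [cite: Schlessinger1968, Lemma 1.4 (ii),
pp. 209–210] -/
theorem IsSmallExtension.isEssential_iff_forall_comp_ne {p : ↥R₁ →ₐ[k] ↥R₀} (hp : IsSmallExtension k p) :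
    ArtAlg.IsEssential p ↔ ∀ s : ↥R₀ →ₐ[k] ↥R₁, p.comp s ≠ AlgHom.id k ↥R₀ := by
  rw [← not_iff_not, hp.not_isEssential_iff_exists_section]
  simp

end Essential

/-! ## Base change: the side of a cartesian square parallel to a small extension is a small extension
([Schlessinger1968, proof of Thm. 2.11, p. 214]: «If the small extension `pr₁` has a section …» for
`pr₁ : R_q ×_A A′ → R_q`, the base change of the small extension `p : A′ → A`) -/

section BaseChange

variable {k : Type u} [Field k] {R₀ R₁ R₂ R₃ : ArtAlg.{u} k}

/-- A commutative square `p ∘ q′ = q ∘ p′` maps `ker p′` into `ker p` (under `q′`).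
[cite: Schlessinger1968, §1 p. 209 (fibre products in `C`)] -/
theorem ArtAlg.map_mem_ker_of_square (p : ↥R₁ →ₐ[k] ↥R₀) (p' : ↥R₃ →ₐ[k] ↥R₂) (q' : ↥R₃ →ₐ[k] ↥R₁)
    (q : ↥R₂ →ₐ[k] ↥R₀) (hsq : p.comp q' = q.comp p') {x : ↥R₃} (hx : x ∈ RingHom.ker p') :
    q' x ∈ RingHom.ker p := by
  rw [RingHom.mem_ker] at hx ⊢
  have h := AlgHom.congr_fun hsq x
  simp only [AlgHom.comp_apply] at h
  rw [h, hx, map_zero]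

/-- In a cartesian square over a surjection `p`, the parallel side `p′` is surjective.
[cite: Schlessinger1968, §1 p. 209 and proof of Thm. 2.11, p. 214] [cite: StacksProject, Tag 06GH] -/
theorem IsCartesian.surjective_side {p : ↥R₁ →ₐ[k] ↥R₀} {q : ↥R₂ →ₐ[k] ↥R₀} {q' : ↥R₃ →ₐ[k] ↥R₁}
    {p' : ↥R₃ →ₐ[k] ↥R₂} (hc : IsCartesian k p q q' p') (hp : Function.Surjective p) :
    Function.Surjective p' := fun a => by
  obtain ⟨b, hb⟩ := hp (q a)
  obtain ⟨d, -, hd⟩ := hc.exists_lift b a hb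
  exact ⟨d, hd⟩

/-- In a cartesian square, `q′` is INJECTIVE on `ker p′` (a lift is determined by its two images, and the image
under `p′` of a kernel element is `0`). [cite: Schlessinger1968, §1 p. 209] [cite: StacksProject, Tag 06GH] -/
theorem IsCartesian.eq_of_mem_ker_of_map_eq {p : ↥R₁ →ₐ[k] ↥R₀} {q : ↥R₂ →ₐ[k] ↥R₀} {q' : ↥R₃ →ₐ[k] ↥R₁}
    {p' : ↥R₃ →ₐ[k] ↥R₂} (hc : IsCartesian k p q q' p') {x y : ↥R₃} (hx : x ∈ RingHom.ker p')
    (hy : y ∈ RingHom.ker p') (h : q' x = q' y) : x = y :=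
  hc.lift_unique x y h (by rw [(RingHom.mem_ker.1 hx : p' x = 0), (RingHom.mem_ker.1 hy : p' y = 0)])

/-- In a cartesian square, every element of `ker p` is `q′` of a (unique) element of `ker p′` (lift the compatible
pair `(i, 0)`). [cite: Schlessinger1968, §1 p. 209] [cite: StacksProject, Tag 06GH] -/
theorem IsCartesian.exists_mem_ker_map_eq {p : ↥R₁ →ₐ[k] ↥R₀} {q : ↥R₂ →ₐ[k] ↥R₀} {q' : ↥R₃ →ₐ[k] ↥R₁}
    {p' : ↥R₃ →ₐ[k] ↥R₂} (hc : IsCartesian k p q q' p') {i : ↥R₁} (hi : i ∈ RingHom.ker p) :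
    ∃ x ∈ RingHom.ker p', q' x = i := by
  obtain ⟨d, hd, hd'⟩ := hc.exists_lift i 0 (by rw [map_zero]; exact RingHom.mem_ker.1 hi)
  exact ⟨d, RingHom.mem_ker.2 hd', hd⟩

/-- A morphism of `Art_k` is LOCAL: it maps the maximal ideal into the maximal ideal (augmentations are unique up
to the identification of residue fields: `aug₁ ∘ q′` is an augmentation of the source).
[cite: Schlessinger1968, §1 p. 208 («local homomorphisms»)] -/
theorem ArtAlg.map_mem_maximalIdeal (q' : ↥R₃ →ₐ[k] ↥R₁) {m : ↥R₃} (hm : m ∈ maximalIdeal ↥R₃) :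
    q' m ∈ maximalIdeal ↥R₁ := by
  obtain ⟨aug₁⟩ := R₁.exists_augmentation
  have h3 : m ∈ RingHom.ker ((aug₁.comp q' : ↥R₃ →ₐ[k] k) : ↥R₃ →+* k) := by
    rw [ArtAlg.ker_augmentation_eq_maximalIdeal]; exact hm
  rw [← ArtAlg.ker_augmentation_eq_maximalIdeal R₁ aug₁, RingHom.mem_ker]
  exact h3

/-- In a cartesian square over `p` with `𝔪 · ker p = 0`, also `𝔪 · ker p′ = 0`.
[cite: Schlessinger1968, Def. 1.2 and proof of Thm. 2.11, p. 214] [cite: StacksProject, Tag 06GH] -/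
theorem IsCartesian.ker_mul_maximalIdeal_side {p : ↥R₁ →ₐ[k] ↥R₀} {q : ↥R₂ →ₐ[k] ↥R₀} {q' : ↥R₃ →ₐ[k] ↥R₁}
    {p' : ↥R₃ →ₐ[k] ↥R₂} (hc : IsCartesian k p q q' p') (hI : RingHom.ker p * maximalIdeal ↥R₁ = ⊥) :
    RingHom.ker p' * maximalIdeal ↥R₃ = ⊥ := by
  rw [← le_bot_iff, Ideal.mul_le]
  intro x hx m hm
  rw [Ideal.mem_bot]
  refine hc.eq_of_mem_ker_of_map_eq (Ideal.mul_mem_right m _ hx) (Ideal.zero_mem _) ?_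
  rw [map_mul, map_zero]
  have h : q' x * q' m ∈ RingHom.ker p * maximalIdeal ↥R₁ :=
    Ideal.mul_mem_mul (ArtAlg.map_mem_ker_of_square p p' q' q hc.comm hx) (ArtAlg.map_mem_maximalIdeal q' hm)
  rw [hI, Ideal.mem_bot] at h
  exact h

/-- **Base change of a small extension is a small extension:** in a cartesian square of `Art_k` over a small
extension `p : R₁ → R₀` ([Schlessinger1968, Def. 1.2]), the parallel side `p′ : R₃ → R₂` is a small extension —
onto, `𝔪 · ker p′ = 0`, and `ker p′ = (t′)` for the unique `t′ ∈ ker p′` over the generator `t` of `ker p` (every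
`z ∈ ker p′` has `q′ z = c · t = q′ (c · t′)`, `c ∈ k`, by `IsSmallExtension.exists_smul_eq_of_mem_ker`). This is the
«small extension `pr₁ : R_q ×_A A′ → R_q`» of the printed hull construction.
[cite: Schlessinger1968, Def. 1.2 (p. 209) and proof of Thm. 2.11 (1), p. 214] [cite: StacksProject, Tag 06GH] -/
theorem IsCartesian.isSmallExtension_side {p : ↥R₁ →ₐ[k] ↥R₀} {q : ↥R₂ →ₐ[k] ↥R₀} {q' : ↥R₃ →ₐ[k] ↥R₁}
    {p' : ↥R₃ →ₐ[k] ↥R₂} (hc : IsCartesian k p q q' p') (hp : IsSmallExtension k p) :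
    IsSmallExtension k p' where
  surjective := hc.surjective_side hp.surjective
  ker_mul_maximalIdeal := hc.ker_mul_maximalIdeal_side hp.ker_mul_maximalIdeal
  exists_ker_eq_span := by
    obtain ⟨t, ht0, hker⟩ := hp.exists_ker_eq_span
    have ht : t ∈ RingHom.ker p := by rw [hker]; exact Ideal.mem_span_singleton_self t
    obtain ⟨t', ht', hqt'⟩ := hc.exists_mem_ker_map_eq ht
    refine ⟨t', fun h => ht0 (by rw [← hqt', h, map_zero]), le_antisymm (fun z hz => ?_) ?_⟩
    · obtain ⟨c, hc'⟩ := hp.exists_smul_eq_of_mem_ker hker (ArtAlg.map_mem_ker_of_square p p' q' q hc.comm hz)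
      have hct' : c • t' ∈ RingHom.ker p' := by
        rw [Algebra.smul_def]; exact Ideal.mul_mem_left _ _ ht'
      have hz' : z = c • t' := hc.eq_of_mem_ker_of_map_eq hz hct' (by rw [map_smul, hqt', hc'])
      rw [hz', Algebra.smul_def]
      exact Ideal.mul_mem_left _ _ (Ideal.mem_span_singleton_self t')
    · rw [Ideal.span_singleton_le_iff_mem]
      exact ht'

end BaseChange

end Literature.AlgebraicGeometry.Deformation
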